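import Mathlib
import HarnessLib

/-!
# Orders and indices of permutation groups preserving a partition, a subset, or a system of
# translates

Topic `Literature/GroupTheory/PermutationGroups`.  Fully PROVED folklore used when bounding
the degrees of the actions of `S_m` from below (index of intransitive and of imprimitive
subgroups of `S_m`; e.g. Maróti 2002, proof of Theorem 1.1, Step 3: "the point stabilizer … is
primitive, imprimitive, or intransitive as a subgroup of `S_m`"):

* `card_le_prod_factorial_of_mapsTo` — if `K ≤ Sym(α)` maps each part `P i` of a covering family
  of finite sets into itself, then `|K| ≤ ∏ᵢ |P i|!` (restriction to the parts is injective).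
* `mapsTo_compl_of_mapsTo`, `card_le_factorial_mul_factorial_of_mapsTo`,
  `choose_le_index_of_mapsTo` — a subgroup leaving a `k`-subset `S` invariant has order
  `≤ k! (n-k)!`, i.e. index `≥ C(n, k)` in `Sym(α)` (it lies in `Sym(S) × Sym(Sᶜ)`).
* `card_le_pow_factorial_mul_factorial_of_translates` — if `H ≤ Sym(α)` is transitive and
  `B ⊆ α` is a non-empty finite set with `b` distinct translates `h • B`, then
  `|H| ≤ (|B|!)^b · b!`: `H` permutes the translates, the kernel of this action preserves each
  translate, and the translates cover `α`.  With `B` a block of imprimitivity (`|B| · b = n`,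
  Mathlib's `MulAction.IsBlock.ncard_block_mul_ncard_orbit_eq`) this is the familiar
  `|H| ≤ |S_a wr S_b| = (a!)^b · b!`, `ab = n` (`card_le_of_isBlock`).
-/

namespace Literature.GroupTheory.PermutationGroups

open Equiv Equiv.Perm MulAction Subgroup
open scoped Pointwise

variable {α : Type*} [Fintype α] [DecidableEq α]

omit [DecidableEq α] in
/-- **Restriction to an invariant covering family is injective**: if every element of
`K ≤ Sym(α)` maps each `P i` into itself and the `P i` cover `α`, then `|K| ≤ ∏ᵢ |P i|!`.
(The parts need not be disjoint.) [folklore] -/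
theorem card_le_prod_factorial_of_mapsTo {ι : Type*} [Fintype ι] (P : ι → Finset α)
    (hcover : ∀ x, ∃ i, x ∈ P i) (K : Subgroup (Perm α))
    (hK : ∀ k ∈ K, ∀ i, ∀ x ∈ P i, k x ∈ P i) :
    Nat.card K ≤ ∏ i, ((P i).card).factorial := by
  classical
  let Φ : K → (∀ i, Perm {x // x ∈ P i}) := fun k i =>
    (k : Perm α).subtypePermOfFintype (p := fun x => x ∈ P i) (fun x hx => hK k k.2 i x hx)
  have hΦ : Function.Injective Φ := by
    intro k k' h
    apply Subtype.ext
    ext x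
    obtain ⟨i, hi⟩ := hcover x
    have h1 : Φ k i ⟨x, hi⟩ = Φ k' i ⟨x, hi⟩ := by rw [h]
    simpa [Φ] using congrArg Subtype.val h1
  calc Nat.card K ≤ Nat.card (∀ i, Perm {x // x ∈ P i}) := Nat.card_le_card_of_injective Φ hΦ
    _ = ∏ i, Nat.card (Perm {x // x ∈ P i}) := Nat.card_pi
    _ = ∏ i, ((P i).card).factorial := by
        refine Finset.prod_congr rfl fun i _ => ?_
        rw [Nat.card_perm, Nat.card_eq_fintype_card, Fintype.card_coe]

omit [Fintype α] in
/-- A permutation mapping a finite set into itself maps its complement into itself. [folklore] -/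
theorem mapsTo_compl_of_mapsTo (S : Finset α) {k : Perm α} (hk : ∀ x ∈ S, k x ∈ S) :
    ∀ x, x ∉ S → k x ∉ S := by
  intro x hx hkx
  have himg : S.image k = S := Finset.eq_of_subset_of_card_le
      (Finset.image_subset_iff.mpr hk) (by rw [Finset.card_image_of_injective _ k.injective])
  rw [← himg, Finset.mem_image] at hkx
  obtain ⟨y, hy, hxy⟩ := hkx
  exact hx (k.injective hxy ▸ hy)

/-- **A subgroup with an invariant `k`-subset lies in `Sym(S) × Sym(Sᶜ)`**:
`|K| ≤ k! · (n - k)!`. [folklore] -/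
theorem card_le_factorial_mul_factorial_of_mapsTo (S : Finset α) (K : Subgroup (Perm α))
    (hK : ∀ k ∈ K, ∀ x ∈ S, k x ∈ S) :
    Nat.card K ≤ S.card.factorial * (Fintype.card α - S.card).factorial := by
  have h := card_le_prod_factorial_of_mapsTo (ι := Bool) (fun b => if b then S else Sᶜ)
    (fun x => if hx : x ∈ S then ⟨true, by simpa using hx⟩
      else ⟨false, by simpa [Finset.mem_compl] using hx⟩) K
    (fun k hk b x hx => by
      cases b
      · simp only [Bool.false_eq_true, ↓reduceIte, Finset.mem_compl] at hx ⊢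
        exact mapsTo_compl_of_mapsTo S (hK k hk) x hx
      · simp only [↓reduceIte] at hx ⊢
        exact hK k hk x hx)
  simpa [Fintype.prod_bool, Finset.card_compl] using h

/-- **Index form**: a subgroup of `Sym(α)` leaving a `k`-subset invariant has index at least
`C(n, k)`. [folklore] -/
theorem choose_le_index_of_mapsTo (S : Finset α) (K : Subgroup (Perm α))
    (hK : ∀ k ∈ K, ∀ x ∈ S, k x ∈ S) : (Fintype.card α).choose S.card ≤ K.index := by
  have h1 := card_le_factorial_mul_factorial_of_mapsTo S K hK
  have h2 : K.index * Nat.card K = (Fintype.card α).factorial := by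
    rw [Subgroup.index_mul_card, Nat.card_perm, Nat.card_eq_fintype_card]
  have h3 := Nat.choose_mul_factorial_mul_factorial (Finset.card_le_univ S)
  have hpos : 0 < Nat.card K := Nat.card_pos
  by_contra hlt
  push Not at hlt
  have : K.index * Nat.card K < (Fintype.card α).choose S.card *
      (S.card.factorial * (Fintype.card α - S.card).factorial) :=
    calc K.index * Nat.card K < (Fintype.card α).choose S.card * Nat.card K :=
          Nat.mul_lt_mul_of_pos_right hlt hpos
      _ ≤ _ := Nat.mul_le_mul_left _ h1
  rw [h2, ← mul_assoc, h3] at this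
  exact lt_irrefl _ this

/-- **A transitive group permuting `b` translates of a set `B` has order `≤ (|B|!)^b · b!`.**
Let `H ≤ Sym(α)` be transitive and `B ⊆ α` finite and non-empty, with set of translates
`𝓑 = {h • B : h ∈ H}` of size `b`.  Then `H → Sym(𝓑)` has image of order `≤ b!` and kernel
preserving every translate; the translates cover `α` (transitivity), so the kernel has order
`≤ ∏_{C ∈ 𝓑} |C|! = (|B|!)^b`. [folklore] -/
theorem card_le_pow_factorial_mul_factorial_of_translates (H : Subgroup (Perm α))
    [IsPretransitive H α] (B : Finset α) (hB : B.Nonempty) :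
    Nat.card H ≤ B.card.factorial ^ Nat.card (orbit H B) * (Nat.card (orbit H B)).factorial := by
  classical
  -- the action on the translates
  let φ : H →* Perm (orbit H B) := MulAction.toPermHom H (orbit H B)
  -- the kernel preserves every translate
  have hker : ∀ k ∈ φ.ker.map H.subtype, ∀ C : orbit H B, ∀ x ∈ (C : Finset α),
      k x ∈ (C : Finset α) := by
    rintro _ ⟨k, hk, rfl⟩ C x hx
    have hk1 : φ k = 1 := hk
    have hC : k • C = C := by
      have := Equiv.Perm.ext_iff.mp hk1 C
      simpa [φ] using this
    have hC' : (k : Perm α) • (C : Finset α) = C := by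
      have := congrArg Subtype.val hC
      simpa [Subgroup.smul_def] using this
    have hmem : (k : Perm α) • x ∈ (k : Perm α) • (C : Finset α) :=
      Finset.smul_mem_smul_finset hx
    rw [hC'] at hmem
    exact hmem
  -- the translates cover `α`
  have hcover : ∀ x, ∃ C : orbit H B, x ∈ (C : Finset α) := by
    intro x
    obtain ⟨y, hy⟩ := hB
    obtain ⟨h, hh⟩ := exists_smul_eq H y x
    refine ⟨⟨h • B, mem_orbit B h⟩, ?_⟩
    rw [← hh]
    exact Finset.smul_mem_smul_finset hy
  have hK := card_le_prod_factorial_of_mapsTo (fun C : orbit H B => (C : Finset α)) hcover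
    (φ.ker.map H.subtype) hker
  -- every translate has `|B|` elements
  have hcardC : ∀ C : orbit H B, ((C : Finset α)).card = B.card := by
    rintro ⟨_, ⟨h, rfl⟩⟩
    exact Finset.card_smul_finset h B
  simp only [hcardC, Finset.prod_const, Finset.card_univ] at hK
  rw [card_subtype, ← Nat.card_eq_fintype_card] at hK
  -- assemble: |H| = |ker φ| · |range φ| ≤ (|B|!)^b · b!
  have hrange : φ.ker.index ≤ (Nat.card (orbit H B)).factorial := by
    rw [index_ker, ← Nat.card_perm]
    exact card_le_card_group φ.range
  calc Nat.card H = Nat.card φ.ker * φ.ker.index := (card_mul_index φ.ker).symm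
    _ ≤ B.card.factorial ^ Nat.card (orbit H B) * (Nat.card (orbit H B)).factorial :=
        Nat.mul_le_mul hK hrange

/-- **Block form** (`|H| ≤ |S_a wr S_b|`): if moreover `B` is a block of imprimitivity for the
transitive `H`, with `|B| = a` and `b` translates, then `a · b = |α|` and `|H| ≤ (a!)^b · b!`.
[folklore] -/
theorem card_le_of_isBlock (H : Subgroup (Perm α)) [IsPretransitive H α] (B : Finset α)
    (hB : B.Nonempty) (hblock : IsBlock H (B : Set α)) :
    B.card * Nat.card (orbit H B) = Fintype.card α ∧
      Nat.card H ≤ B.card.factorial ^ Nat.card (orbit H B) *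
        (Nat.card (orbit H B)).factorial := by
  classical
  refine ⟨?_, card_le_pow_factorial_mul_factorial_of_translates H B hB⟩
  have key := hblock.ncard_block_mul_ncard_orbit_eq (by exact_mod_cast hB)
  rw [Set.ncard_coe_finset, Nat.card_eq_fintype_card] at key
  -- the orbits of `B` as a finset and as a set correspond under the injective map `(↑)`
  have horb : (orbit H (B : Set α)) = (fun C : Finset α => (C : Set α)) '' orbit H B := by
    ext C
    simp only [mem_orbit_iff, Set.mem_image]
    constructor
    · rintro ⟨h, rfl⟩
      exact ⟨h • B, ⟨h, rfl⟩, by simp⟩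
    · rintro ⟨_, ⟨h, rfl⟩, rfl⟩
      exact ⟨h, by simp⟩
  rw [horb, Set.ncard_image_of_injective _ Finset.coe_injective, ← Nat.card_coe_set_eq] at key
  exact key
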